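import Mathlib
import HarnessLib
import Summits.ResolutionOfSingularities.ResolutionOfSingularities.Theorems.WildQuotientsWildQuotientResolutionS1aSymRoot
import Summits.ResolutionOfSingularities.ResolutionOfSingularities.Theorems.WildQuotientsWildQuotientResolutionS1aA1Cover

/-!
# S1a — THE SYMMETRIC ROOT MOVE, cover: the σ-fixed norm cover `(x₀^{δdp}, N(x₁)^{(δ+1)δd}, N(x₂)^{(δ+1)δd})` of degree `d·(δ+1)δp` and its `hrad`

[OURS · L1 W4.5c · lead-1 g14; R3 brick 2 (after ✓`…S1aSymRoot`); pattern ✓`…S1aA1Cover`] — NOT statements of the manuscript; counted 0; AI-level work, weaker than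
expert review. Crux stmt-ResolutionOfSingularities-17941 `CyclicQuotientFourfolds`, line `s1a-logminvertex` v13 (`stub_reachLowerInFX`).

Centre `f = (e⁻¹x₀, e⁻¹x₁, e⁻¹x₂)`, weights `(δ+1, 1, 1)` (`…S1aSymRoot`); `σx₁ = x₁ + x₀`, `σx₂ = x₂ + x₀`. Norms `N_j = ∏_{i : ZMod p} (e⁻¹x_j + i·e⁻¹x₀)` (`j = 1, 2`).
* `mem_radical_of_prod_add_mul` — abstract core of every norm-chart `hrad`: `∏ᵢ (U + aᵢB) ∈ √I`, `B ∈ √I` ⇒ `U ∈ √I`;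
* `sym_norm_two_fixed` (and ✓`A1.a1_norm_fixed` for `N₁`), `sym_norm_mem` (`N_j ∈ 𝒥_p`), `sym_cover_zero_mem` / `sym_cover_norm_mem` (degree `d·((δ+1)δp)`),
  `sym_cover_zero_fixed`, `sym_norm_T` (`N_j T^p = ∏ (u_j′ + i·u₀′ s^δ)`), ★ `sym_hrad` (all three irrelevant generators lie in `√(c₀, c₁, c₂)`).
-/

set_option linter.dupNamespace false

noncomputable section

open Literature.AlgebraicGeometry.Resolution
open scoped LaurentPolynomial
open MvPolynomial
open Summit.ResolutionOfSingularities.ResolutionOfSingularities.Theorems.WildQuotientResolution.S1.CoarseChart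
open Summit.ResolutionOfSingularities.ResolutionOfSingularities.Theorems.WildQuotientResolution.S1.BlowupCharts

namespace Summit.ResolutionOfSingularities.ResolutionOfSingularities.Theorems.WildQuotientResolution.S1.KillCert.Sym

/-- **Abstract norm-chart radical step**: if `B ∈ √I` and `∏_{i : ZMod p} (U + aᵢ·B) ∈ √I` then `U ∈ √I` (`∏ (U + aᵢB) ≡ U^p mod B`). [folklore] -/
theorem mem_radical_of_prod_add_mul {R : Type*} [CommRing R] {p : ℕ} [NeZero p] (I : Ideal R) (U B : R) (a : ZMod p → R)
    (hB : B ∈ I.radical) (hP : ∏ i : ZMod p, (U + a i * B) ∈ I.radical) : U ∈ I.radical := by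
  have hdiff : (∏ i : ZMod p, (U + a i * B)) - U ^ p ∈ Ideal.span {B} := prod_add_mul_sub_pow_mem U B a
  have h2 : (∏ i : ZMod p, (U + a i * B)) - U ^ p ∈ I.radical := (Ideal.span_singleton_le_iff_mem _ |>.mpr hB) hdiff
  have hUp : U ^ p ∈ I.radical := by
    have := sub_mem hP h2
    rwa [sub_sub_cancel] at this
  exact Ideal.mem_radical_of_pow_mem hUp

variable {k : Type} [Field k] {A : Type} [CommRing A]
  (σ : MvPolynomial (Fin 4) k ≃+* MvPolynomial (Fin 4) k)
  (h0 : σ (X 0) = X 0) (h1 : σ (X 1) = X 1 + X 0) (h2 : σ (X 2) = X 2 + X 0) (δ : ℕ)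
  (e : A ≃+* MvPolynomial (Fin 4) k) (τ : A ≃+* A) (hact : ∀ t : A, τ t = e.symm (σ (e t))) {p : ℕ}

include hact h0 h2 in
/-- The norm `N₂ = ∏ (e⁻¹x₂ + i·e⁻¹x₀)` is `τ`-fixed. -/
theorem sym_norm_two_fixed [NeZero p] [CharP A p] (hp1 : p ≠ 1) :
    τ (∏ i : ZMod p, (e.symm (X 2) + (i.val : A) * e.symm (X 0))) = ∏ i : ZMod p, (e.symm (X 2) + (i.val : A) * e.symm (X 0)) := by
  rw [map_prod]
  have hτ : ∀ i : ZMod p, τ (e.symm (X 2) + (i.val : A) * e.symm (X 0)) = e.symm (X 2) + ((i + 1).val : A) * e.symm (X 0) := by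
    intro i
    rw [map_add, map_mul, map_natCast, A1.act_symm σ e τ hact, A1.act_symm σ e τ hact, h2, h0, map_add]
    have hval : ((i + 1).val : A) = (i.val : A) + 1 := by
      rw [ZMod.val_add, ZMod.val_one'' hp1, ← CharP.cast_eq_mod A p (i.val + 1), Nat.cast_add, Nat.cast_one]
    rw [hval]; ring
  simp_rw [hτ]
  exact Fintype.prod_equiv (Equiv.addRight 1) _ _ fun i => rfl

/-- The norms lie in `𝒥_p` (each factor in `𝒥₁`). -/
theorem sym_norm_mem [NeZero p] (j : Fin 4) (hj : e.symm (X j) ∈ (weightedFiltration (e.symm ∘ ![X 0, X 1, X 2] : Fin 3 → A) ![δ + 1, 1, 1]).ideal 1) :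
    (∏ i : ZMod p, (e.symm (X j) + (i.val : A) * e.symm (X 0))) ∈ (weightedFiltration (e.symm ∘ ![X 0, X 1, X 2] : Fin 3 → A) ![δ + 1, 1, 1]).ideal p := by
  have hX0 : e.symm (X 0) ∈ (weightedFiltration (e.symm ∘ ![X 0, X 1, X 2] : Fin 3 → A) ![δ + 1, 1, 1]).ideal 1 :=
    (weightedFiltration _ _).antitone (show 1 ≤ (![δ + 1, 1, 1] : Fin 3 → ℕ) 0 by change 1 ≤ δ + 1; omega)
      (mem_weightedFiltration_ideal (e.symm ∘ ![X 0, X 1, X 2] : Fin 3 → A) ![δ + 1, 1, 1] 0)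
  have hfac : ∀ i : ZMod p, e.symm (X j) + (i.val : A) * e.symm (X 0) ∈ (weightedFiltration (e.symm ∘ ![X 0, X 1, X 2] : Fin 3 → A) ![δ + 1, 1, 1]).ideal 1 :=
    fun i => add_mem hj (Ideal.mul_mem_left _ _ hX0)
  have := Ideal.prod_mem_prod (s := (Finset.univ : Finset (ZMod p))) (fun i _ => hfac i)
  rw [Finset.prod_const, Finset.card_univ, ZMod.card] at this
  have hle := Veronese.idealFiltration_pow_le (weightedFiltration (e.symm ∘ ![X 0, X 1, X 2] : Fin 3 → A) ![δ + 1, 1, 1]) 1 p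
  rw [one_mul] at hle
  exact hle this

/-- **Cover element 0**: `x₀^{δdp} ∈ 𝒥_{d·((δ+1)δp)}`. -/
theorem sym_cover_zero_mem (d : ℕ) :
    e.symm (X 0) ^ (δ * (d * p)) ∈ (weightedFiltration (e.symm ∘ ![X 0, X 1, X 2] : Fin 3 → A) ![δ + 1, 1, 1]).ideal (d * ((δ + 1) * δ * p)) := by
  have h := GameFrame.GModel.pow_mem_weightedFiltration_ideal (e.symm ∘ ![X 0, X 1, X 2] : Fin 3 → A) ![δ + 1, 1, 1] 0 (δ * (d * p))
  have e1 : δ * (d * p) * ((![δ + 1, 1, 1] : Fin 3 → ℕ) 0) = d * ((δ + 1) * δ * p) := by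
    change δ * (d * p) * (δ + 1) = _; ring
  rwa [e1] at h

/-- **Cover elements 1, 2**: `N_j^{(δ+1)δd} ∈ 𝒥_{d·((δ+1)δp)}`. -/
theorem sym_cover_norm_mem [NeZero p] (d : ℕ) (j : Fin 4) (hj : e.symm (X j) ∈ (weightedFiltration (e.symm ∘ ![X 0, X 1, X 2] : Fin 3 → A) ![δ + 1, 1, 1]).ideal 1) :
    (∏ i : ZMod p, (e.symm (X j) + (i.val : A) * e.symm (X 0))) ^ ((δ + 1) * δ * d) ∈
      (weightedFiltration (e.symm ∘ ![X 0, X 1, X 2] : Fin 3 → A) ![δ + 1, 1, 1]).ideal (d * ((δ + 1) * δ * p)) := by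
  have h := Ideal.pow_mem_pow (sym_norm_mem δ e (p := p) j hj) ((δ + 1) * δ * d)
  have hle := Veronese.idealFiltration_pow_le (weightedFiltration (e.symm ∘ ![X 0, X 1, X 2] : Fin 3 → A) ![δ + 1, 1, 1]) p ((δ + 1) * δ * d)
  have e1 : p * ((δ + 1) * δ * d) = d * ((δ + 1) * δ * p) := by ring
  rw [e1] at hle
  exact hle h

include hact h0 in
/-- Cover element 0 is `τ`-fixed. -/
theorem sym_cover_zero_fixed (n : ℕ) : τ (e.symm (X 0) ^ n) = e.symm (X 0) ^ n := by
  rw [map_pow, A1.act_symm σ e τ hact, h0]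

/-- `N_j·T^p = ∏ (u_j″ + i·(u₀′ s^δ))` in `A[T;T⁻¹]`, where `u_j″ = C(e⁻¹x_j)·T`. -/
theorem sym_norm_T [NeZero p] (j : Fin 4) : LaurentPolynomial.C (∏ i : ZMod p, (e.symm (X j) + (i.val : A) * e.symm (X 0))) * LaurentPolynomial.T (p : ℤ) =
    ∏ i : ZMod p, (LaurentPolynomial.C (e.symm (X j)) * LaurentPolynomial.T 1 +
      (i.val : A[T;T⁻¹]) * (LaurentPolynomial.C (e.symm (X 0)) * LaurentPolynomial.T ((δ + 1 : ℕ) : ℤ) * LaurentPolynomial.T (-(δ : ℤ)))) := by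
  have hfac : ∀ i : ZMod p, LaurentPolynomial.C (e.symm (X j)) * LaurentPolynomial.T 1 +
      (i.val : A[T;T⁻¹]) * (LaurentPolynomial.C (e.symm (X 0)) * LaurentPolynomial.T ((δ + 1 : ℕ) : ℤ) * LaurentPolynomial.T (-(δ : ℤ))) =
      LaurentPolynomial.C (e.symm (X j) + (i.val : A) * e.symm (X 0)) * LaurentPolynomial.T 1 := by
    intro i
    rw [mul_assoc, ← LaurentPolynomial.T_add, map_add, map_mul, map_natCast]
    have e1 : ((δ + 1 : ℕ) : ℤ) + -(δ : ℤ) = 1 := by push_cast; ring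
    rw [e1]; ring
  simp_rw [hfac]
  rw [Finset.prod_mul_distrib, ← map_prod, Finset.prod_const, Finset.card_univ, ZMod.card, LaurentPolynomial.T_pow, mul_one]

/-- ★ **`hrad` for the symmetric root**: with the cover `c₀ = x₀^{δdp}T^{dbar}`, `c_j = N_j^{(δ+1)δd}T^{dbar}` (`dbar = d(δ+1)δp`), all three irrelevant generators
`u₀′, u₁′, u₂′` lie in `√(c₀, c₁, c₂)`. [OURS · L1 W4.5c · symmetric root] -/
theorem sym_hrad [NeZero p] (d : ℕ) (c : Fin 3 → ↥(cobordantAlgebra (e.symm ∘ ![X 0, X 1, X 2] : Fin 3 → A) ![δ + 1, 1, 1]))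
    (hc₀ : (c 0 : A[T;T⁻¹]) = LaurentPolynomial.C (e.symm (X 0) ^ (δ * (d * p))) * LaurentPolynomial.T ((d * ((δ + 1) * δ * p) : ℕ) : ℤ))
    (hc₁ : (c 1 : A[T;T⁻¹]) = LaurentPolynomial.C ((∏ i : ZMod p, (e.symm (X 1) + (i.val : A) * e.symm (X 0))) ^ ((δ + 1) * δ * d)) *
      LaurentPolynomial.T ((d * ((δ + 1) * δ * p) : ℕ) : ℤ))
    (hc₂ : (c 2 : A[T;T⁻¹]) = LaurentPolynomial.C ((∏ i : ZMod p, (e.symm (X 2) + (i.val : A) * e.symm (X 0))) ^ ((δ + 1) * δ * d)) *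
      LaurentPolynomial.T ((d * ((δ + 1) * δ * p) : ℕ) : ℤ)) (i : Fin 3) :
    cobordantAlgebra.u' (e.symm ∘ ![X 0, X 1, X 2] : Fin 3 → A) ![δ + 1, 1, 1] i ∈ (Ideal.span (Set.range c)).radical := by
  set U₀ := cobordantAlgebra.u' (e.symm ∘ ![X 0, X 1, X 2] : Fin 3 → A) ![δ + 1, 1, 1] 0 with hU₀
  set s := cobordantAlgebra.s (e.symm ∘ ![X 0, X 1, X 2] : Fin 3 → A) ![δ + 1, 1, 1] with hs
  -- `u₀′^{δdp} = c₀`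
  have hX0 : U₀ ^ (δ * (d * p)) = c 0 := by
    refine Subtype.ext ?_
    rw [SubmonoidClass.coe_pow, hU₀, cobordantAlgebra.coe_u', hc₀]
    change (LaurentPolynomial.C (e.symm (X 0)) * LaurentPolynomial.T ((δ + 1 : ℕ) : ℤ)) ^ (δ * (d * p)) = _
    rw [mul_pow, ← map_pow, LaurentPolynomial.T_pow]
    congr 2
    push_cast
    ring
  have hX0rad : U₀ ∈ (Ideal.span (Set.range c)).radical := ⟨δ * (d * p), by rw [hX0]; exact Ideal.subset_span ⟨0, rfl⟩⟩
  have hBrad : U₀ * s ^ δ ∈ (Ideal.span (Set.range c)).radical := Ideal.mul_mem_right _ _ hX0rad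
  -- the norm charts
  have key : ∀ (j : Fin 4) (U : ↥(cobordantAlgebra (e.symm ∘ ![X 0, X 1, X 2] : Fin 3 → A) ![δ + 1, 1, 1]))
      (hU : (U : A[T;T⁻¹]) = LaurentPolynomial.C (e.symm (X j)) * LaurentPolynomial.T 1) (cj : ↥(cobordantAlgebra (e.symm ∘ ![X 0, X 1, X 2] : Fin 3 → A) ![δ + 1, 1, 1]))
      (hcj : (cj : A[T;T⁻¹]) = LaurentPolynomial.C ((∏ i : ZMod p, (e.symm (X j) + (i.val : A) * e.symm (X 0))) ^ ((δ + 1) * δ * d)) *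
        LaurentPolynomial.T ((d * ((δ + 1) * δ * p) : ℕ) : ℤ)) (hcjmem : cj ∈ (Ideal.span (Set.range c)).radical),
      U ∈ (Ideal.span (Set.range c)).radical := by
    intro j U hU cj hcj hcjmem
    have hprod : (∏ i : ZMod p, (U + algebraMap A _ (i.val : A) * (U₀ * s ^ δ))) ^ ((δ + 1) * δ * d) = cj := by
      refine Subtype.ext ?_
      rw [SubmonoidClass.coe_pow, SubmonoidClass.coe_finsetProd, hcj]
      have hi : ∀ i : ZMod p, ((U + algebraMap A _ (i.val : A) * (U₀ * s ^ δ) : ↥(cobordantAlgebra (e.symm ∘ ![X 0, X 1, X 2] : Fin 3 → A) ![δ + 1, 1, 1])) : A[T;T⁻¹]) =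
          LaurentPolynomial.C (e.symm (X j)) * LaurentPolynomial.T 1 +
            (i.val : A[T;T⁻¹]) * (LaurentPolynomial.C (e.symm (X 0)) * LaurentPolynomial.T ((δ + 1 : ℕ) : ℤ) * LaurentPolynomial.T (-(δ : ℤ))) := by
        intro i
        rw [AddMemClass.coe_add, MulMemClass.coe_mul, MulMemClass.coe_mul, hU, hU₀, hs, cobordantAlgebra.coe_u', cobordantAlgebra.coe_s_pow,
          cobordantAlgebra.coe_algebraMap, map_natCast]
        rfl
      simp_rw [hi]
      rw [← sym_norm_T δ e (p := p) j, mul_pow, ← map_pow, LaurentPolynomial.T_pow]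
      congr 2
      push_cast
      ring
    have hP : (∏ i : ZMod p, (U + algebraMap A _ (i.val : A) * (U₀ * s ^ δ))) ∈ (Ideal.span (Set.range c)).radical := by
      have hpow : (∏ i : ZMod p, (U + algebraMap A _ (i.val : A) * (U₀ * s ^ δ))) ^ ((δ + 1) * δ * d) ∈ (Ideal.span (Set.range c)).radical := by
        rw [hprod]; exact hcjmem
      exact Ideal.mem_radical_of_pow_mem hpow
    exact mem_radical_of_prod_add_mul _ U (U₀ * s ^ δ) (fun i => algebraMap A _ (i.val : A)) hBrad hP
  fin_cases i
  · exact hX0rad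
  · exact key 1 _ (by rw [cobordantAlgebra.coe_u']; rfl) (c 1) hc₁ (Ideal.le_radical (Ideal.subset_span ⟨1, rfl⟩))
  · exact key 2 _ (by rw [cobordantAlgebra.coe_u']; rfl) (c 2) hc₂ (Ideal.le_radical (Ideal.subset_span ⟨2, rfl⟩))

end Summit.ResolutionOfSingularities.ResolutionOfSingularities.Theorems.WildQuotientResolution.S1.KillCert.Sym

end
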